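import Mathlib
import Literature.AlgebraicGeometry.Resolution.BlowupChartRsop
import Literature.AlgebraicGeometry.Resolution.AffineBlowupAlgebra
import HarnessLib

/-!
# Root-chart presentations of Rees charts: the chart ring as a subalgebra of a polynomial ring (generic)

(crux stmt-ResolutionOfSingularities-15640 `WildQuotients.WildQuotientResolution`, line `Sketch`,
sector `|G| = p`; programmes V3U/V4U of `L/w45c/CHAIN.md` v5 (toric exits: the SINGULAR vertex
charts of `Bl_{(x_a,x_b²)}` / `Bl_{I₆}` are quotient singularities, i.e. invariant subrings of a
polynomial «root chart»); [OURS · L1 W4.5c] — NOT a statement of any manuscript.)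

GENERIC ENGINE (the pattern of `ToricExit.chartA_ringEquiv_adjoin`, p486657, with the data
abstracted): let `c : Fin m → k[x]`, `cᵢ ≠ 0`, and let `ψ₀ : k[x] → k[x]` be an INJECTIVE
`k`-algebra endomorphism (the root substitution, e.g. `x_a ↦ ρ²`, `x_b ↦ ρβ`) such that `ψ₀(cᵢ)`
divides a power of `cᵢ` and `ψ₀(c_j) = q_j · ψ₀(cᵢ)` for explicit quotients `q_j`. Then the Rees
chart ring `(k[x][It])_{(cᵢ t)} ≅ k[x][I/cᵢ]` is isomorphic, as a ring, to the subalgebra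
`k[ψ₀(x₁), …, ψ₀(xₙ), q₁, …, q_m] ⊆ k[x]`, the isomorphism carrying `chartBase` to `ψ₀` and the
chart generator `(c_j t)/(cᵢ t)` to `q_j` (`nonempty_chartRing_ringEquiv_adjoin_of_rootData`).
Instances: V3U chart a (`ψ₀ = (ρ², ρβ)`, `q = (1, β²)`), V4U charts `D₊(x_b³ t)` (`μ₂`, Veronese)
and `D₊(x_a² t)` (`μ₃`) of `Bl_{I₆}`.
-/

-- single-problem summit: the doubled namespace component `ResolutionOfSingularities` is forced
set_option linter.dupNamespace false

noncomputable section

open MvPolynomial IsLocalization Literature.AlgebraicGeometry.Resolution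

namespace Summit.ResolutionOfSingularities.ResolutionOfSingularities.Theorems.WildQuotientResolution.ToricExit

/-- **Root-chart presentation of a Rees chart (generic).** For `c : Fin m → k[x₁,…,xₙ]` with
`cᵢ ≠ 0`, an injective `k`-algebra endomorphism `ψ₀` of `k[x]` with `ψ₀(cᵢ) · r = cᵢ^N` and
`ψ₀(c_j) = q_j · ψ₀(cᵢ)` for all `j`, there is a ring isomorphism from the chart ring
`(k[x][It])_{(cᵢt)}`, `I = (c)`, onto the subalgebra of `k[x]` generated by the `ψ₀(x_s)` and the
`q_j`, carrying the structure map `chartBase` to `ψ₀` and the chart generators `(c_j t)/(cᵢ t)` to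
`q_j`. Proof: `reesChartEquiv` onto the affine blowup algebra `k[x][I/cᵢ] ⊆ k[x][1/cᵢ]`, then the
extension `h₀` of `ψ₀` to `k[x][1/cᵢ]` (injective since `ψ₀` is), whose image of `k[x][I/cᵢ]` is
`ι(k[ψ₀(x), q])`, then `Subalgebra.equivMapOfInjective`. [folklore] -/
theorem nonempty_chartRing_ringEquiv_adjoin_of_rootData (k : Type) [Field k] {n m : ℕ}
    (c : Fin m → MvPolynomial (Fin n) k) (i : Fin m) (hci : c i ≠ 0)
    (ψ₀ : MvPolynomial (Fin n) k →ₐ[k] MvPolynomial (Fin n) k) (hψinj : Function.Injective ψ₀)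
    (r : MvPolynomial (Fin n) k) (N : ℕ) (hunit : ψ₀ (c i) * r = c i ^ N)
    (q : Fin m → MvPolynomial (Fin n) k) (hq : ∀ j, ψ₀ (c j) = q j * ψ₀ (c i)) :
    ∃ e : chartRing c i ≃+*
        ↥(Algebra.adjoin k (Set.range (fun s : Fin n => ψ₀ (X s)) ∪ Set.range q)),
      (∀ f : MvPolynomial (Fin n) k,
        ((e (chartBase c i f) :
            ↥(Algebra.adjoin k (Set.range (fun s : Fin n => ψ₀ (X s)) ∪ Set.range q))) :
          MvPolynomial (Fin n) k) = ψ₀ f) ∧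
      ∀ j : Fin m,
        ((e (chartGen c i j) :
            ↥(Algebra.adjoin k (Set.range (fun s : Fin n => ψ₀ (X s)) ∪ Set.range q))) :
          MvPolynomial (Fin n) k) = q j := by
  classical
  set S : Set (MvPolynomial (Fin n) k) := Set.range (fun s : Fin n => ψ₀ (X s)) ∪ Set.range q
    with hS
  set E : Subalgebra k (MvPolynomial (Fin n) k) := Algebra.adjoin k S with hE
  have hES : ∀ s, ψ₀ (X s) ∈ E := fun s => Algebra.subset_adjoin (Or.inl ⟨s, rfl⟩)
  have hEq : ∀ j, q j ∈ E := fun j => Algebra.subset_adjoin (Or.inr ⟨j, rfl⟩)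
  -- `ψ₀` lands in `E`
  have hψE : ∀ f, ψ₀ f ∈ E := by
    intro f
    induction f using MvPolynomial.induction_on with
    | C t =>
      rw [← MvPolynomial.algebraMap_eq, AlgHom.commutes]
      exact Subalgebra.algebraMap_mem _ _
    | add p p' hp hq' =>
      rw [map_add]
      exact Subalgebra.add_mem _ hp hq'
    | mul_X p s hp =>
      rw [map_mul]
      exact Subalgebra.mul_mem _ hp (hES s)
  -- the localisation `k[x][1/cᵢ]`
  set L := Localization.Away (c i)
  set ι := algebraMap (MvPolynomial (Fin n) k) L with hιdef
  let ιₐ : MvPolynomial (Fin n) k →ₐ[k] L := IsScalarTower.toAlgHom k (MvPolynomial (Fin n) k) L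
  have hιₐ : ∀ x, ιₐ x = ι x := fun x => rfl
  have hιinj : Function.Injective ι :=
    IsLocalization.injective L (M := Submonoid.powers (c i))
      (Submonoid.powers_le.2 (mem_nonZeroDivisors_of_ne_zero hci))
  have hιₐinj : Function.Injective ιₐ := hιinj
  have hu : ι (c i) * Away.invSelf (c i) = 1 := Away.mul_invSelf (c i)
  -- the extension `h₀` of `ψ₀`
  let g : MvPolynomial (Fin n) k →+* L := ι.comp ψ₀.toRingHom
  have hg : IsUnit (g (c i)) := by
    change IsUnit (ι (ψ₀ (c i)))
    have hN : IsUnit (ι (c i ^ N)) := by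
      rw [map_pow]
      exact (IsLocalization.Away.algebraMap_isUnit (S := L) (c i)).pow N
    rw [← hunit, map_mul] at hN
    exact isUnit_of_mul_isUnit_left hN
  let h₀ : L →+* L := IsLocalization.Away.lift (c i) hg
  have hh₀ι : ∀ x, h₀ (ι x) = ι (ψ₀ x) := fun x => IsLocalization.Away.lift_eq (c i) hg x
  have hh₀inv : ι (ψ₀ (c i)) * h₀ (Away.invSelf (c i)) = 1 := by
    have h1 : h₀ (ι (c i) * Away.invSelf (c i)) = 1 := by rw [hu, map_one]
    rwa [map_mul, hh₀ι] at h1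
  -- `h₀` is injective
  have hh₀inj : Function.Injective h₀ := by
    rw [injective_iff_map_eq_zero]
    intro z hz
    obtain ⟨⟨x, s⟩, hzr⟩ := IsLocalization.surj (Submonoid.powers (c i)) z
    change z * ι s = ι x at hzr
    have hx : ψ₀ x = 0 := by
      apply hιinj
      rw [map_zero, ← hh₀ι, ← hzr, map_mul, hz, zero_mul]
    have hx0 : x = 0 := hψinj (by rw [hx, map_zero])
    rw [hx0, map_zero] at hzr
    exact (IsLocalization.map_units L s).mul_left_eq_zero.mp hzr
  -- the affine blowup algebra and its image
  set Bl := blowupAlgebra (Ideal.span (Set.range c)) (c i) with hBl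
  have hgenq : ∀ j, h₀ (ι (c j) * Away.invSelf (c i)) = ι (q j) := by
    intro j
    rw [map_mul, hh₀ι, hq j, map_mul, mul_assoc, hh₀inv, mul_one]
  -- (i) `h₀(Bl) ⊆ ι(E)`
  have hsub : ∀ z, z ∈ Bl → h₀ z ∈ E.map ιₐ := by
    intro z hz
    refine Algebra.adjoin_induction (fun y hy => ?_) (fun x => ?_) (fun _ _ _ _ hx hy => ?_)
      (fun _ _ _ _ hx hy => ?_) hz
    · obtain ⟨x, hx, rfl⟩ := hy
      -- `x ∈ (c)`: `x = Σ d_j c_j`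
      obtain ⟨d, rfl⟩ := Ideal.mem_span_range_iff_exists_fun.mp hx
      have hw : ∑ j, ψ₀ (d j) * q j ∈ E :=
        Subalgebra.sum_mem _ fun j _ => Subalgebra.mul_mem _ (hψE (d j)) (hEq j)
      refine Subalgebra.mem_map.mpr ⟨_, hw, ?_⟩
      change ι (∑ j, ψ₀ (d j) * q j) = h₀ (ι (∑ j, d j * c j) * Away.invSelf (c i))
      have hsum : ψ₀ (∑ j, d j * c j) = (∑ j, ψ₀ (d j) * q j) * ψ₀ (c i) := by
        rw [map_sum, Finset.sum_mul]
        refine Finset.sum_congr rfl fun j _ => ?_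
        rw [map_mul, hq j, mul_assoc]
      rw [map_mul, hh₀ι, hsum, map_mul, mul_assoc, hh₀inv, mul_one]
    · refine Subalgebra.mem_map.mpr ⟨ψ₀ x, hψE x, ?_⟩
      rw [hιₐ, ← hh₀ι]
    · rw [map_add]; exact Subalgebra.add_mem _ hx hy
    · rw [map_mul]; exact Subalgebra.mul_mem _ hx hy
  -- (ii) `ι(E) ⊆ h₀(Bl)`
  have hsup : ∀ y, y ∈ E → ∃ z, z ∈ Bl ∧ h₀ z = ι y := by
    intro y hy
    refine Algebra.adjoin_induction (fun y hy => ?_) (fun t => ?_) (fun _ _ _ _ hx hy => ?_)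
      (fun _ _ _ _ hx hy => ?_) hy
    · rcases hy with ⟨s, rfl⟩ | ⟨j, rfl⟩
      · exact ⟨ι (X s), Subalgebra.algebraMap_mem _ _, hh₀ι (X s)⟩
      · exact ⟨ι (c j) * Away.invSelf (c i),
          div_mem_blowupAlgebra _ _ (Ideal.mem_span_range_self (f := c) (x := j)), hgenq j⟩
    · refine ⟨ι (C t), Subalgebra.algebraMap_mem _ _, ?_⟩
      rw [hh₀ι, ← MvPolynomial.algebraMap_eq, AlgHom.commutes]
    · obtain ⟨z₁, hz₁, h₁⟩ := hx
      obtain ⟨z₂, hz₂, h₂⟩ := hy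
      exact ⟨z₁ + z₂, Subalgebra.add_mem _ hz₁ hz₂, by rw [map_add, h₁, h₂, map_add]⟩
    · obtain ⟨z₁, hz₁, h₁⟩ := hx
      obtain ⟨z₂, hz₂, h₂⟩ := hy
      exact ⟨z₁ * z₂, Subalgebra.mul_mem _ hz₁ hz₂, by rw [map_mul, h₁, h₂, map_mul]⟩
  -- the isomorphism `Bl ≃ E.map ιₐ ≃ E`
  let Φ : Bl →+* ↥(E.map ιₐ) :=
    (h₀.comp Bl.toSubring.subtype).codRestrict (E.map ιₐ).toSubring fun z => hsub z z.2
  have hΦ : Function.Bijective Φ := by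
    refine ⟨fun z₁ z₂ h => Subtype.ext (hh₀inj (congrArg Subtype.val h)), fun y => ?_⟩
    obtain ⟨w, hw, hwy⟩ := Subalgebra.mem_map.mp y.2
    obtain ⟨z, hz, hzw⟩ := hsup w hw
    exact ⟨⟨z, hz⟩, Subtype.ext (by rw [← hwy]; exact hzw)⟩
  let e₁ : Bl ≃+* ↥(E.map ιₐ) := RingEquiv.ofBijective Φ hΦ
  let e₂ : ↥(E.map ιₐ) ≃+* ↥E := (Subalgebra.equivMapOfInjective E ιₐ hιₐinj).symm.toRingEquiv
  have he₂ : ∀ (w : MvPolynomial (Fin n) k) (hw : w ∈ E) (hw' : ι w ∈ E.map ιₐ),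
      (e₂ ⟨ι w, hw'⟩ : MvPolynomial (Fin n) k) = w := by
    intro w hw hw'
    have h : (Subalgebra.equivMapOfInjective E ιₐ hιₐinj) ⟨w, hw⟩ = ⟨ι w, hw'⟩ :=
      Subtype.ext (Subalgebra.coe_equivMapOfInjective_apply E ιₐ hιₐinj ⟨w, hw⟩)
    have h' : e₂ ⟨ι w, hw'⟩ = ⟨w, hw⟩ := by
      change (Subalgebra.equivMapOfInjective E ιₐ hιₐinj).symm ⟨ι w, hw'⟩ = ⟨w, hw⟩
      rw [AlgEquiv.symm_apply_eq, h]
    rw [h']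
  refine ⟨(reesChartEquiv (c i) (Ideal.mem_span_range_self (f := c) (x := i))).trans (e₁.trans e₂),
    fun f => ?_, fun j => ?_⟩
  · have h1 : reesChartEquiv (c i) (Ideal.mem_span_range_self (f := c) (x := i)) (chartBase c i f) =
        algebraMap (MvPolynomial (Fin n) k) Bl f := reesChartEquiv_reesChartBase _ _ f
    have h2 : e₁ (algebraMap (MvPolynomial (Fin n) k) Bl f) =
        ⟨ι (ψ₀ f), Subalgebra.mem_map.mpr ⟨ψ₀ f, hψE f, rfl⟩⟩ := by
      apply Subtype.ext
      change h₀ (ι f) = ι (ψ₀ f)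
      exact hh₀ι f
    rw [RingEquiv.trans_apply, RingEquiv.trans_apply, h1, h2, he₂ (ψ₀ f) (hψE f)]
  · have h1 : ((reesChartEquiv (c i) (Ideal.mem_span_range_self (f := c) (x := i))
        (chartGen c i j) : Bl) : L) = ι (c j) * Away.invSelf (c i) := by
      rw [coe_reesChartEquiv]
      change reesChart (c i) _ (HomogeneousLocalization.Away.mk _ _ 1 (reesT (c j) _) _) = _
      rw [reesChart_mk (c i) _ (reesT_mem_one_smul c j) (coe_reesT (c j) _), pow_one]
    have hmem : ι (q j) ∈ E.map ιₐ := Subalgebra.mem_map.mpr ⟨q j, hEq j, rfl⟩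
    have h2 : e₁ (reesChartEquiv (c i) (Ideal.mem_span_range_self (f := c) (x := i))
        (chartGen c i j)) = ⟨ι (q j), hmem⟩ := by
      apply Subtype.ext
      change h₀ ((reesChartEquiv (c i) _ (chartGen c i j) : Bl) : L) = ι (q j)
      rw [h1, hgenq j]
    rw [RingEquiv.trans_apply, RingEquiv.trans_apply, h2, he₂ (q j) (hEq j) hmem]

end Summit.ResolutionOfSingularities.ResolutionOfSingularities.Theorems.WildQuotientResolution.ToricExit

end
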